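import Summits.ABC.IUTFork.Cor312SoundInput
import Summits.ABC.IUTFork.Cor312TeamAGapWitnessB
import Summits.ABC.IUTFork.Cor312SoundInputChecks
import Summits.ABC.IUTFork.Cor312SoundInputTwoObjects
import HarnessLib

/-!
# [IUTchIII] Cor. 3.12 — (G3) for the gap statement OF RECORD: `SoundAtInput` is not derivable from the typed interfaces

Record-only, PROOF-ONLY file (D-0012) of the abc-iut cell; support piece for TEAM A row A-4 (plan/C312-TEAMS.md;
GapA of record = `Summit.ABC.IUTFork.Cor312Vol.SoundAtInput`, abc-iut-c312-9, `Cor312SoundInput.lean` p413249;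
GAP-LEDGER row G-c312-9-1), seat abc-iut-w5-d154 (WAVE 5). TAKES NO SIDE.

plan/ADJUDICATION-SPEC.md §2 (G3) asks, for the STRONG grade of non-derivability, for "a kernel countermodel
`∃ P, F.Statement ∧ BridgeHyps P ∧ … ∧ ¬ GapA P` (interface-level independence — the shape of
`thm311_bridgeHyps_not_imp_statement`, which already gives it for GapA := Statement itself)". This file writes
that sentence's FQN LITERALLY for GapA := `SoundAtInput`, by composing two landed theorems and nothing else:

* `not_soundAtInput_of_not_statement` — contrapositive of abc-iut-c312-9's `statement_of_soundAtInput`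
  (GapA ⟹ Statement): wherever the typed Statement fails, soundness-at-input fails for EVERY value-group gluing;
* `nonempty_linkGluing` — every setting carries at least one `LinkGluing` (the constant gluing `o ↦ P.qPilot`
  satisfies Step (xi-a)'s only typed requirement `linkMap P.thetaPilot = P.qPilot`), so the universal
  quantifier over gluings below is never vacuous;
* `thm311_bridgeHyps_not_imp_soundAtInput` — at TEAM A's landed gap setting
  (`GapWitness.thm311_bridgeHyps_not_imp_statement`, `Cor312TeamAGapWitnessB.lean` p411346): typed Thm 3.11
  holds, `BridgeHyps` and `AbsLogQPos` hold, a gluing exists, and `SoundAtInput` FAILS for every gluing;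
* `thm311_bridgeHyps_not_imp_soundAtFiniteInputs` — the same for the FINITENESS-GUARDED shape of
  abc-iut-w5-d193's `Cor312SoundInputChecks.lean` (p413764, finding F-d193-3: GapA's finiteness conjunct at
  non-pilot inputs is stronger than print; the guarded shape drops it): since `BridgeHyps.finite` supplies
  `ThetaFinite`, `statement_of_soundAtFiniteInputs` funnels the guarded shape to the Statement as well, so it
  too fails at the gap setting for every gluing — the (G3) non-derivability is insensitive to that repair.

HONEST SCOPE: interface-level independence only (the toy gap setting is not the assembled real setting of initial
Θ-data and instantiates no FACT-LIST fact); it bounds what a (P)-theorem can look like exactly as the negative of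
record does, now phrased for the GapA of record. Nothing here asserts that `SoundAtInput` holds or fails at any
real setting, nor anything about [IUTchIII] Cor. 3.12. [claim: Mochizuki2012, status: disputed]
-/

noncomputable section

namespace Summit.ABC

namespace IUTFork

namespace Cor312Vol

open Thm311 Cor312 Literature.IUT.LogThetaLattice

variable {T : ThetaIndex} {S : Situation T} (P : Cor312.Setting S)

/-- Contrapositive of `statement_of_soundAtInput` (abc-iut-c312-9): if the typed Cor. 3.12 `Statement` fails at a
setting, then soundness of the multiradial algorithm at its input fails there for EVERY value-group gluing `G`.
[claim: Mochizuki2012, status: disputed] -/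
theorem not_soundAtInput_of_not_statement (G : Summit.ABC.IUTFork.Cor312Vol.LinkGluing P)
    (h : ¬ P.Statement) : ¬ Summit.ABC.IUTFork.Cor312Vol.SoundAtInput P G :=
  fun hs => h (Summit.ABC.IUTFork.Cor312Vol.statement_of_soundAtInput P G hs)

/-- Every setting carries at least one value-group gluing in the sense of `LinkGluing` (Step (xi-a) as typed):
the constant gluing `o ↦ P.qPilot`. Hence statements of the form `∀ G : LinkGluing P, …` are never vacuously
true. (The genuine gluing of [IUTchIII] Cor. 3.12 Step (xi-a) is of course not the constant one; this is a
non-vacuity certificate for the typed quantifier only.) [folklore] -/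
theorem nonempty_linkGluing : Nonempty (Summit.ABC.IUTFork.Cor312Vol.LinkGluing P) :=
  ⟨{ linkMap := fun _ => P.qPilot, link_thetaPilot := rfl }⟩

/-- **(G3) STRONG, for the gap statement of record.** Typed [IUTchIII] Thm 3.11 (`FullSituation.Statement`)
together with the bridge side conditions `BridgeHyps` and `AbsLogQPos` does NOT imply `SoundAtInput` uniformly
over settings: at TEAM A's gap setting (abc-iut-c312-9, `GapWitness.gapSetting`, where `−|log(Θ)| = −2` and
`−|log(q)| = −1`) all premises hold, a value-group gluing exists, and soundness-at-input fails for every gluing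
(else `statement_of_soundAtInput` would give the Statement, refuted there by `gapSetting_not_statement`). This is
plan/ADJUDICATION-SPEC.md §2 (G3) in its literal shape `∃ P, F.Statement ∧ BridgeHyps P ∧ … ∧ ¬ GapA P` with
GapA := `SoundAtInput` (interface level; no FACT-LIST fact is instantiated at the toy setting).
[claim: Mochizuki2012, status: disputed] -/
theorem thm311_bridgeHyps_not_imp_soundAtInput :
    ∃ (T : ThetaIndex) (F : Summit.ABC.IUTFork.Thm311.FullSituation T)
      (P : Summit.ABC.IUTFork.Cor312.Setting F.toLatticeSituation.toSituation),
      F.Statement ∧ Summit.ABC.IUTFork.Cor312Vol.BridgeHyps P ∧ P.AbsLogQPos ∧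
        Nonempty (Summit.ABC.IUTFork.Cor312Vol.LinkGluing P) ∧
          ∀ G : Summit.ABC.IUTFork.Cor312Vol.LinkGluing P,
            ¬ Summit.ABC.IUTFork.Cor312Vol.SoundAtInput P G := by
  obtain ⟨T, F, P, hF, hB, hA, hnot⟩ := GapWitness.thm311_bridgeHyps_not_imp_statement
  exact ⟨T, F, P, hF, hB, hA, nonempty_linkGluing P, fun G => not_soundAtInput_of_not_statement P G hnot⟩

/-- The same, with an EXHIBITED gluing (existential form): some setting satisfying typed Thm 3.11 + `BridgeHyps`
+ `AbsLogQPos` carries a gluing `G` with `¬ SoundAtInput P G`. [claim: Mochizuki2012, status: disputed] -/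
theorem exists_linkGluing_not_soundAtInput :
    ∃ (T : ThetaIndex) (F : Summit.ABC.IUTFork.Thm311.FullSituation T)
      (P : Summit.ABC.IUTFork.Cor312.Setting F.toLatticeSituation.toSituation)
      (G : Summit.ABC.IUTFork.Cor312Vol.LinkGluing P),
      F.Statement ∧ Summit.ABC.IUTFork.Cor312Vol.BridgeHyps P ∧ P.AbsLogQPos ∧
        ¬ Summit.ABC.IUTFork.Cor312Vol.SoundAtInput P G := by
  obtain ⟨T, F, P, hF, hB, hA, ⟨G⟩, hall⟩ := thm311_bridgeHyps_not_imp_soundAtInput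
  exact ⟨T, F, P, G, hF, hB, hA, hall G⟩

/-- **(G3) STRONG for the finiteness-GUARDED shape of GapA** (abc-iut-w5-d193, `Cor312SoundInputChecks.lean`,
finding F-d193-3 / `statement_of_soundAtFiniteInputs`): typed Thm 3.11 + `BridgeHyps` + `AbsLogQPos` do NOT imply
"for every input `o` with finite hull volume, `−|log(q)|(G o) ≤ −|log(Θ)|(o)`" either — at the gap setting
`BridgeHyps.finite` gives `ThetaFinite`, so the guarded shape would again yield the Statement, refuted there.
Hence the interface-level non-derivability (G3) does not depend on whether GapA carries the finiteness
conjunct at non-pilot inputs. [claim: Mochizuki2012, status: disputed] -/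
theorem thm311_bridgeHyps_not_imp_soundAtFiniteInputs :
    ∃ (T : ThetaIndex) (F : Summit.ABC.IUTFork.Thm311.FullSituation T)
      (P : Summit.ABC.IUTFork.Cor312.Setting F.toLatticeSituation.toSituation),
      F.Statement ∧ Summit.ABC.IUTFork.Cor312Vol.BridgeHyps P ∧ P.AbsLogQPos ∧
        Nonempty (Summit.ABC.IUTFork.Cor312Vol.LinkGluing P) ∧
          ∀ G : Summit.ABC.IUTFork.Cor312Vol.LinkGluing P,
            ¬ (∀ o : P.Ob P.sig.Clgp, Summit.ABC.IUTFork.Cor312Vol.negLogThetaAt P o ≠ ⊤ →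
                ((Summit.ABC.IUTFork.Cor312Vol.negLogQAt P (G.linkMap o) : ℝ) : WithTop ℝ) ≤
                  Summit.ABC.IUTFork.Cor312Vol.negLogThetaAt P o) := by
  obtain ⟨T, F, P, hF, hB, hA, hnot⟩ := GapWitness.thm311_bridgeHyps_not_imp_statement
  exact ⟨T, F, P, hF, hB, hA, nonempty_linkGluing P,
    fun G h => hnot (statement_of_soundAtFiniteInputs P G hB.finite h)⟩

end Cor312Vol

end IUTFork

end Summit.ABC

end

/-! ## Appendix (v2, 2026-08-26): the finiteness-GUARDED shape is ALSO strictly stronger than the typed Corollary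

abc-iut-w5-d193 (`Cor312SoundInputChecks`, F-d193-3) separated GapA from the Statement through the FINITENESS
conjunct at a non-pilot input and observed that the guarded shape survives THAT witness
(`soundAtFiniteInputs_toySettingTwo`). abc-iut-w5-d236's two-object setting (`Cor312SoundInputTwoObjects`,
p414131: second object with FINITE hull volume `−2` but `q`-side volume `−1` under the identity gluing) breaks the
INEQUALITY conjunct instead — and therefore the guarded shape as well. Recorded here so that the GAP-LEDGER
wording (G-c312-9-1) can state the quantifier level of EITHER shape: both are strictly stronger than the
typed Corollary over the frozen interfaces (plan/ADJUDICATION-SPEC.md §2 (G1′)). Composition only; no side taken.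
-/

namespace Summit.ABC.IUTFork.Cor312Vol

open Thm311 Cor312

/-- **The guarded shape of GapA is still STRICTLY STRONGER than the typed Corollary** (interface level): at
abc-iut-w5-d236's two-object setting typed Thm 3.11, `BridgeHyps`, `AbsLogQPos` AND the typed Cor. 3.12
`Statement` all hold, yet "for every input `o` with finite hull volume, `−|log(q)|(G o) ≤ −|log(Θ)|(o)`" FAILS
for the exhibited (identity) gluing: the second object has hull volume `−2 ≠ ⊤` and `q`-side volume `−1`.
So dropping the finiteness conjunct (the F-d193-3 repair) does not bring GapA down to the strength of the
Corollary; the surplus is the inequality at non-pilot inputs. [claim: Mochizuki2012, status: disputed] -/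
theorem statement_not_imp_soundAtFiniteInputs :
    ∃ (T : ThetaIndex) (F : Summit.ABC.IUTFork.Thm311.FullSituation T)
      (P : Summit.ABC.IUTFork.Cor312.Setting F.toLatticeSituation.toSituation)
      (G : Summit.ABC.IUTFork.Cor312Vol.LinkGluing P),
      F.Statement ∧ Summit.ABC.IUTFork.Cor312Vol.BridgeHyps P ∧ P.AbsLogQPos ∧ P.Statement ∧
        ¬ (∀ o : P.Ob P.sig.Clgp, Summit.ABC.IUTFork.Cor312Vol.negLogThetaAt P o ≠ ⊤ →
            ((Summit.ABC.IUTFork.Cor312Vol.negLogQAt P (G.linkMap o) : ℝ) : WithTop ℝ) ≤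
              Summit.ABC.IUTFork.Cor312Vol.negLogThetaAt P o) := by
  have key : ¬ (∀ o : TwoObjectWitness.twoSetting.Ob TwoObjectWitness.twoSetting.sig.Clgp,
      negLogThetaAt TwoObjectWitness.twoSetting o ≠ ⊤ →
        ((negLogQAt TwoObjectWitness.twoSetting (TwoObjectWitness.idGluing.linkMap o) : ℝ) : WithTop ℝ) ≤
          negLogThetaAt TwoObjectWitness.twoSetting o) := by
    intro h
    have hfin : negLogThetaAt TwoObjectWitness.twoSetting false ≠ ⊤ := by
      rw [TwoObjectWitness.two_negLogThetaAt_false]; exact WithTop.coe_ne_top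
    have hle := h false hfin
    rw [TwoObjectWitness.two_negLogThetaAt_false, show TwoObjectWitness.idGluing.linkMap false = false from rfl,
      TwoObjectWitness.two_negLogQAt_false, WithTop.coe_le_coe] at hle
    norm_num at hle
  exact ⟨_, _, TwoObjectWitness.twoSetting, TwoObjectWitness.idGluing,
    GapWitness.gapFull_statement, TwoObjectWitness.twoSetting_bridgeHyps, TwoObjectWitness.twoSetting_absLogQPos,
    TwoObjectWitness.twoSetting_statement, key⟩

/-- Summary of the interface-level separations now in the tree, as one conjunction (for the 12:30Z block):
(1) typed Thm 3.11 + `BridgeHyps` + `AbsLogQPos` ⊬ GapA (`thm311_bridgeHyps_not_imp_soundAtInput`);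
(2) the same premises + the typed Cor. 3.12 `Statement` ⊬ GapA, even finiteness-guarded
(`statement_not_imp_soundAtFiniteInputs`, witness abc-iut-w5-d236). [claim: Mochizuki2012, status: disputed] -/
theorem soundAtInput_separations :
    (∃ (T : ThetaIndex) (F : Summit.ABC.IUTFork.Thm311.FullSituation T)
        (P : Summit.ABC.IUTFork.Cor312.Setting F.toLatticeSituation.toSituation),
        F.Statement ∧ Summit.ABC.IUTFork.Cor312Vol.BridgeHyps P ∧ P.AbsLogQPos ∧
          Nonempty (Summit.ABC.IUTFork.Cor312Vol.LinkGluing P) ∧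
            ∀ G : Summit.ABC.IUTFork.Cor312Vol.LinkGluing P,
              ¬ Summit.ABC.IUTFork.Cor312Vol.SoundAtInput P G) ∧
    (∃ (T : ThetaIndex) (F : Summit.ABC.IUTFork.Thm311.FullSituation T)
        (P : Summit.ABC.IUTFork.Cor312.Setting F.toLatticeSituation.toSituation)
        (G : Summit.ABC.IUTFork.Cor312Vol.LinkGluing P),
        F.Statement ∧ Summit.ABC.IUTFork.Cor312Vol.BridgeHyps P ∧ P.AbsLogQPos ∧ P.Statement ∧
          ¬ (∀ o : P.Ob P.sig.Clgp, Summit.ABC.IUTFork.Cor312Vol.negLogThetaAt P o ≠ ⊤ →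
              ((Summit.ABC.IUTFork.Cor312Vol.negLogQAt P (G.linkMap o) : ℝ) : WithTop ℝ) ≤
                Summit.ABC.IUTFork.Cor312Vol.negLogThetaAt P o)) :=
  ⟨thm311_bridgeHyps_not_imp_soundAtInput, statement_not_imp_soundAtFiniteInputs⟩

end Summit.ABC.IUTFork.Cor312Vol
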